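import Summits.QuantumFields.YangMills.Theorems.BalabanLadderIRAfOnsetSliceSums

/-!
# Crux `IR` (stmt-QuantumFields-19354), line `af-pincer`, stub `stub_afOnsetUc : AFToOnsetUKPc` (X-side):
# the double sums of the bare two-point function against the envelope kernel, uniformly in the unit

Third file of the chain `…AfOnsetRiemannSums → …AfOnsetSliceSums → …AfOnsetDoubleSums / …AfOnsetTails → IR/AfPincerUcXCov`
(seat ym-19354-afpincer-s2, generation 2).  For `F, G : ℝ⁴ → ℝ` with `|F u|, |G u| ≤ C |u 0|³ (1+‖u‖)⁻¹⁰`, `F = 0` on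
`{0 ≤ u 0}` and `G = 0` on `{u 0 ≤ 0}` (the pair `(θv, v)` of the X-stub), and every unit `s > 0`:

* `outer_sum_le` — the row-then-time sum at negative times `Σ_{x : x 0 ≤ −1} (s a)³(1+s a)⁻³ a⁻² (1+s‖x'‖)⁻⁷ ≤ Z₃ s / min(s,1)³`;
* **`doubleSum_kernel8_le`** `Σ_{x ∈ X, y ∈ Y} |F(s x)| |G(s y)| (1+‖x−y‖)⁻⁸ ≤ 64 C² Z₃² (s / min(s,1))³` — BOUNDED
  uniformly in `s ∈ (0, s₀]` although the sum has `≍ s⁻⁸` terms: the scale invariance of the dimension-4 envelope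
  against the cubic vanishing at the time-zero plane;
* `doubleSum_kernel7_le` (exponent 7: `≤ 64 C² Z₃² s² / min(s,1)³`) and **`doubleSum_kernel8_far_le`** — the pairs with
  `R < s‖x − y‖` (physical separation `> R` in the unit `s`) contribute `≤ 64 C² Z₃² s³ / (min(s,1)³ R)`, i.e. `O(1/R)`
  uniformly in `s ∈ (0, s₀]`.

HONEST FRAMING.  Elementary real analysis (folklore); nothing about Yang–Mills is asserted; one open stub of one open
gap-crux of a CONDITIONAL chain (Track A 0/28 UV); not a gap claim.
-/

set_option autoImplicit false

noncomputable section

open Filter Topology Finset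
open scoped BigOperators
open Literature.MathematicalPhysics.QuantumLattice
open Literature.Probability.LatticeModels (Site box mem_box)
open Summit.QuantumFields.YangMills.Theorems.OSLegsFromFemtoAndGap (summable_inv_succ_sq mul_norm_le_norm_smul_siteToE)

namespace Summit.QuantumFields.YangMills.Cruxes.IR.AfOnset

/-! ## §4 The double sums -/
section DoubleSums

variable {F G : EuclideanSpace ℝ (Fin 4) → ℝ} {C : ℝ}

/-- **Row-then-time sum at negative times**: with `a = −x 0 ≥ 1`,
`Σ_{x : x 0 ≤ −1} (s a)³(1+s a)⁻³ a⁻² (1 + s‖x'‖)⁻⁷ ≤ Z₃ s / min(s,1)³`. [folklore] -/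
theorem outer_sum_le {s : ℝ} (hs : 0 < s) (X : Finset (Site 4)) :
    ∑ x ∈ X.filter (fun x => x 0 ≤ -1),
        (s * (-(x 0 : ℝ))) ^ 3 / (1 + s * (-(x 0 : ℝ))) ^ 3 / (-(x 0 : ℝ)) ^ 2 *
          ((1 + s * ‖Fin.tail x‖) ^ 7)⁻¹ ≤
      (3 ^ 3 * ∑' k : ℕ, (((k : ℝ) + 1) ^ 2)⁻¹) * s / (min s 1) ^ 3 := by
  classical
  set Z : ℝ := 3 ^ 3 * ∑' k : ℕ, (((k : ℝ) + 1) ^ 2)⁻¹ with hZ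
  have hZ0 : 0 ≤ Z := riemann_const_nonneg 3
  have hmin : 0 < min s 1 := lt_min hs one_pos
  set Xf := X.filter (fun x => x 0 ≤ -1) with hXf
  set g : Site 4 → ℕ := fun x => (-(x 0)).toNat with hg
  rw [← Finset.sum_fiberwise_of_maps_to (g := g) (t := Xf.image g) (fun x hx => Finset.mem_image_of_mem g hx)]
  have hA : ∀ a ∈ Xf.image g, 1 ≤ a := by
    intro a ha
    obtain ⟨x, hx, rfl⟩ := Finset.mem_image.1 ha
    have hx1 : x 0 ≤ -1 := (Finset.mem_filter.1 hx).2
    have : (1 : ℤ) ≤ ((-(x 0)).toNat : ℤ) := by rw [Int.toNat_of_nonneg (by omega)]; omega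
    exact_mod_cast this
  have hfib : ∀ a ∈ Xf.image g,
      ∑ x ∈ Xf.filter (fun x => g x = a),
          (s * (-(x 0 : ℝ))) ^ 3 / (1 + s * (-(x 0 : ℝ))) ^ 3 / (-(x 0 : ℝ)) ^ 2 * ((1 + s * ‖Fin.tail x‖) ^ 7)⁻¹ ≤
        Z / (min s 1) ^ 3 * (s ^ 3 * (a : ℝ) / (1 + s * (a : ℝ)) ^ 3) := by
    intro a ha
    have ha1 : 1 ≤ a := hA a ha
    have hxa : ∀ x ∈ Xf.filter (fun x => g x = a), (-(x 0 : ℝ)) = (a : ℝ) := by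
      intro x hx
      have hx' := Finset.mem_filter.1 hx
      have hx1 : x 0 ≤ -1 := (Finset.mem_filter.1 hx'.1).2
      have h : ((-(x 0)).toNat : ℤ) = -(x 0) := Int.toNat_of_nonneg (by omega)
      have hgx : (-(x 0)).toNat = a := by have := hx'.2; simpa [hg] using this
      have h' : (-(x 0) : ℤ) = (a : ℤ) := by rw [← h, hgx]
      exact_mod_cast h'
    have ha0 : (0 : ℝ) < a := by exact_mod_cast ha1
    have hre : ∑ x ∈ Xf.filter (fun x => g x = a),
          (s * (-(x 0 : ℝ))) ^ 3 / (1 + s * (-(x 0 : ℝ))) ^ 3 / (-(x 0 : ℝ)) ^ 2 * ((1 + s * ‖Fin.tail x‖) ^ 7)⁻¹ =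
        (s * a) ^ 3 / (1 + s * a) ^ 3 / (a : ℝ) ^ 2 *
          ∑ x ∈ Xf.filter (fun x => g x = a), ((1 + s * ‖Fin.tail x‖) ^ 7)⁻¹ := by
      rw [Finset.mul_sum]
      refine Finset.sum_congr rfl fun x hx => ?_
      rw [hxa x hx]
    have hinj : Set.InjOn (Fin.tail : Site 4 → Site 3) ↑(Xf.filter (fun x => g x = a)) := by
      intro x₁ hx₁ x₂ hx₂ ht
      have h1 : (-(x₁ 0 : ℝ)) = a := hxa x₁ hx₁
      have h2 : (-(x₂ 0 : ℝ)) = a := hxa x₂ hx₂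
      have h0 : x₁ 0 = x₂ 0 := by
        have : (x₁ 0 : ℝ) = (x₂ 0 : ℝ) := by linarith
        exact_mod_cast this
      exact eq_of_apply_zero_eq_of_tail_eq h0 ht
    have hrow : ∑ x ∈ Xf.filter (fun x => g x = a), ((1 + s * ‖Fin.tail x‖) ^ 7)⁻¹ ≤ Z / (min s 1) ^ 3 := by
      have himg := Finset.sum_image (f := fun z : Site 3 => ((1 + s * ‖z‖) ^ 7)⁻¹) hinj
      rw [← himg]
      exact sum_inv_pow_le_dim hs (by norm_num) _
    rw [hre]
    have hφ0 : 0 ≤ (s * a) ^ 3 / (1 + s * a) ^ 3 / (a : ℝ) ^ 2 := by positivity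
    refine (mul_le_mul_of_nonneg_left hrow hφ0).trans (le_of_eq ?_)
    field_simp
  calc ∑ a ∈ Xf.image g, ∑ x ∈ Xf.filter (fun x => g x = a),
          (s * (-(x 0 : ℝ))) ^ 3 / (1 + s * (-(x 0 : ℝ))) ^ 3 / (-(x 0 : ℝ)) ^ 2 * ((1 + s * ‖Fin.tail x‖) ^ 7)⁻¹
      ≤ ∑ a ∈ Xf.image g, Z / (min s 1) ^ 3 * (s ^ 3 * (a : ℝ) / (1 + s * (a : ℝ)) ^ 3) := Finset.sum_le_sum hfib
    _ = Z / (min s 1) ^ 3 * ∑ a ∈ Xf.image g, s ^ 3 * (a : ℝ) / (1 + s * (a : ℝ)) ^ 3 := by rw [Finset.mul_sum]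
    _ ≤ Z / (min s 1) ^ 3 * s := mul_le_mul_of_nonneg_left (sum_cube_mul_div_le hs _ hA) (by positivity)
    _ = Z * s / (min s 1) ^ 3 := by ring

/-- Terms with `F(s x) = 0` off `{x 0 ≤ −1}`: the outer sum may be restricted. [folklore] -/
theorem sum_eq_sum_filter_neg (hF0 : ∀ u : EuclideanSpace ℝ (Fin 4), 0 ≤ u 0 → F u = 0) {s : ℝ} (hs : 0 < s)
    (X : Finset (Site 4)) (h : Site 4 → ℝ) :
    ∑ x ∈ X, |F (s • siteToE x)| * h x = ∑ x ∈ X.filter (fun x => x 0 ≤ -1), |F (s • siteToE x)| * h x := by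
  classical
  rw [Finset.sum_filter_of_ne]
  intro x _ hne
  by_contra hx
  have hx0 : (0 : ℝ) ≤ (x 0 : ℝ) := by
    have : 0 ≤ x 0 := by omega
    exact_mod_cast this
  have hzero : F (s • siteToE x) = 0 :=
    hF0 _ (by rw [show (s • siteToE x) 0 = s * (x 0 : ℝ) by simp [siteToE_apply]]; positivity)
  exact hne (by rw [hzero, abs_zero, zero_mul])

/-- Terms with `G(s y) = 0` off `{1 ≤ y 0}`: the inner sum may be restricted. [folklore] -/
theorem sum_eq_sum_filter_pos (hG0 : ∀ u : EuclideanSpace ℝ (Fin 4), u 0 ≤ 0 → G u = 0) {s : ℝ} (hs : 0 < s)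
    (Y : Finset (Site 4)) (h : Site 4 → ℝ) :
    ∑ y ∈ Y, |G (s • siteToE y)| * h y = ∑ y ∈ Y.filter (fun y => 1 ≤ y 0), |G (s • siteToE y)| * h y := by
  classical
  rw [Finset.sum_filter_of_ne]
  intro y _ hne
  by_contra hy
  have hy0 : (y 0 : ℝ) ≤ 0 := by
    have : y 0 ≤ 0 := by omega
    exact_mod_cast this
  have hzero : G (s • siteToE y) = 0 := hG0 _ (by
    rw [show (s • siteToE y) 0 = s * (y 0 : ℝ) by simp [siteToE_apply]]
    exact mul_nonpos_of_nonneg_of_nonpos hs.le hy0)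
  exact hne (by rw [hzero, abs_zero, zero_mul])

/-- **The double sum against the envelope kernel, uniformly in the unit**: for `F` vanishing on `{0 ≤ u 0}`, `G` on
`{u 0 ≤ 0}`, both with the cubic bound of order 10,
`Σ_{x ∈ X, y ∈ Y} |F(s x)| |G(s y)| (1+‖x−y‖)⁻⁸ ≤ 64 C² Z₃² (s / min(s,1))³` — bounded for `s ∈ (0, s₀]`. [folklore] -/
theorem doubleSum_kernel8_le (hC : 0 ≤ C)
    (hF : ∀ u : EuclideanSpace ℝ (Fin 4), |F u| ≤ C * |u 0| ^ 3 / (1 + ‖u‖) ^ 10)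
    (hF0 : ∀ u : EuclideanSpace ℝ (Fin 4), 0 ≤ u 0 → F u = 0)
    (hG : ∀ u : EuclideanSpace ℝ (Fin 4), |G u| ≤ C * |u 0| ^ 3 / (1 + ‖u‖) ^ 10)
    (hG0 : ∀ u : EuclideanSpace ℝ (Fin 4), u 0 ≤ 0 → G u = 0)
    {s : ℝ} (hs : 0 < s) (X Y : Finset (Site 4)) :
    ∑ x ∈ X, ∑ y ∈ Y, |F (s • siteToE x)| * |G (s • siteToE y)| * ((1 + ‖x - y‖) ^ 8)⁻¹ ≤
      64 * C ^ 2 * (3 ^ 3 * ∑' k : ℕ, (((k : ℝ) + 1) ^ 2)⁻¹) ^ 2 * (s / min s 1) ^ 3 := by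
  classical
  set Z : ℝ := 3 ^ 3 * ∑' k : ℕ, (((k : ℝ) + 1) ^ 2)⁻¹ with hZ
  have hZ0 : 0 ≤ Z := riemann_const_nonneg 3
  have hmin : 0 < min s 1 := lt_min hs one_pos
  -- restrict both sums
  have hout : ∑ x ∈ X, ∑ y ∈ Y, |F (s • siteToE x)| * |G (s • siteToE y)| * ((1 + ‖x - y‖) ^ 8)⁻¹ =
      ∑ x ∈ X.filter (fun x => x 0 ≤ -1), ∑ y ∈ Y.filter (fun y => 1 ≤ y 0),
        |F (s • siteToE x)| * |G (s • siteToE y)| * ((1 + ‖x - y‖) ^ 8)⁻¹ := by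
    have h1 : ∀ x, ∑ y ∈ Y, |F (s • siteToE x)| * |G (s • siteToE y)| * ((1 + ‖x - y‖) ^ 8)⁻¹ =
        |F (s • siteToE x)| * ∑ y ∈ Y, |G (s • siteToE y)| * ((1 + ‖x - y‖) ^ 8)⁻¹ := by
      intro x; rw [Finset.mul_sum]; exact Finset.sum_congr rfl fun y _ => by ring
    have h2 : ∀ x, ∑ y ∈ Y.filter (fun y => 1 ≤ y 0), |F (s • siteToE x)| * |G (s • siteToE y)| *
        ((1 + ‖x - y‖) ^ 8)⁻¹ =
        |F (s • siteToE x)| * ∑ y ∈ Y.filter (fun y => 1 ≤ y 0), |G (s • siteToE y)| * ((1 + ‖x - y‖) ^ 8)⁻¹ := by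
      intro x; rw [Finset.mul_sum]; exact Finset.sum_congr rfl fun y _ => by ring
    simp_rw [h1]
    rw [sum_eq_sum_filter_neg hF0 hs]
    refine Finset.sum_congr rfl fun x _ => ?_
    rw [sum_eq_sum_filter_pos hG0 hs, h2]
  rw [hout]
  -- termwise bound
  have hterm : ∀ x ∈ X.filter (fun x => x 0 ≤ -1), ∀ y ∈ Y.filter (fun y => 1 ≤ y 0),
      |F (s • siteToE x)| * |G (s • siteToE y)| * ((1 + ‖x - y‖) ^ 8)⁻¹ ≤
        64 * C ^ 2 * ((s * (-(x 0 : ℝ))) ^ 3 / (1 + s * (-(x 0 : ℝ))) ^ 3 * ((1 + s * ‖Fin.tail x‖) ^ 7)⁻¹) *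
          ((s * (y 0 : ℝ)) ^ 3 / (1 + s * (y 0 : ℝ)) ^ 3 /
            ((-(x 0 : ℝ) + (y 0 : ℝ)) ^ 2 * (1 + (-(x 0 : ℝ) + (y 0 : ℝ)) + ‖Fin.tail x - Fin.tail y‖) ^ 6)) := by
    intro x hx y hy
    have hx1 : x 0 ≤ -1 := (Finset.mem_filter.1 hx).2
    have hy1 : 1 ≤ y 0 := (Finset.mem_filter.1 hy).2
    have h1 := abs_apply_smul_le_row hC hF hs x hx1
    have h2 := abs_apply_smul_le_col hC hG hs y hy1
    have h3 := inv_pow_eight_le x y hx1 hy1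
    have ha : (1 : ℝ) ≤ -(x 0 : ℝ) := by
      have : ((x 0 : ℤ) : ℝ) ≤ -1 := by exact_mod_cast hx1
      linarith
    have hb : (1 : ℝ) ≤ (y 0 : ℝ) := by exact_mod_cast hy1
    calc |F (s • siteToE x)| * |G (s • siteToE y)| * ((1 + ‖x - y‖) ^ 8)⁻¹
        ≤ (C * ((s * (-(x 0 : ℝ))) ^ 3 / (1 + s * (-(x 0 : ℝ))) ^ 3) * ((1 + s * ‖Fin.tail x‖) ^ 7)⁻¹) *
          (C * ((s * (y 0 : ℝ)) ^ 3 / (1 + s * (y 0 : ℝ)) ^ 3)) *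
          (64 / ((-(x 0 : ℝ) + (y 0 : ℝ)) ^ 2 * (1 + (-(x 0 : ℝ) + (y 0 : ℝ)) + ‖Fin.tail x - Fin.tail y‖) ^ 6)) :=
          mul_le_mul (mul_le_mul h1 h2 (abs_nonneg _) (by positivity)) h3 (by positivity) (by positivity)
      _ = _ := by ring
  -- inner sums
  have hinner : ∀ x ∈ X.filter (fun x => x 0 ≤ -1),
      ∑ y ∈ Y.filter (fun y => 1 ≤ y 0), |F (s • siteToE x)| * |G (s • siteToE y)| * ((1 + ‖x - y‖) ^ 8)⁻¹ ≤
        64 * C ^ 2 * ((s * (-(x 0 : ℝ))) ^ 3 / (1 + s * (-(x 0 : ℝ))) ^ 3 * ((1 + s * ‖Fin.tail x‖) ^ 7)⁻¹) *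
          (Z * s ^ 2 / (-(x 0 : ℝ)) ^ 2) := by
    intro x hx
    have hx1 : x 0 ≤ -1 := (Finset.mem_filter.1 hx).2
    have ha : (1 : ℝ) ≤ -(x 0 : ℝ) := by
      have : ((x 0 : ℤ) : ℝ) ≤ -1 := by exact_mod_cast hx1
      linarith
    refine (Finset.sum_le_sum (hterm x hx)).trans ?_
    rw [← Finset.mul_sum]
    exact mul_le_mul_of_nonneg_left (inner_sum_eight_le hs ha (Fin.tail x) Y) (by positivity)
  refine (Finset.sum_le_sum hinner).trans ?_
  have hre : ∀ x : Site 4,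
      64 * C ^ 2 * ((s * (-(x 0 : ℝ))) ^ 3 / (1 + s * (-(x 0 : ℝ))) ^ 3 * ((1 + s * ‖Fin.tail x‖) ^ 7)⁻¹) *
          (Z * s ^ 2 / (-(x 0 : ℝ)) ^ 2) =
        64 * C ^ 2 * Z * s ^ 2 * ((s * (-(x 0 : ℝ))) ^ 3 / (1 + s * (-(x 0 : ℝ))) ^ 3 / (-(x 0 : ℝ)) ^ 2 *
          ((1 + s * ‖Fin.tail x‖) ^ 7)⁻¹) := by
    intro x; ring
  simp_rw [hre]
  rw [← Finset.mul_sum]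
  calc 64 * C ^ 2 * Z * s ^ 2 * ∑ x ∈ X.filter (fun x => x 0 ≤ -1),
          (s * (-(x 0 : ℝ))) ^ 3 / (1 + s * (-(x 0 : ℝ))) ^ 3 / (-(x 0 : ℝ)) ^ 2 * ((1 + s * ‖Fin.tail x‖) ^ 7)⁻¹
      ≤ 64 * C ^ 2 * Z * s ^ 2 * (Z * s / (min s 1) ^ 3) :=
        mul_le_mul_of_nonneg_left (outer_sum_le hs X) (by positivity)
    _ = 64 * C ^ 2 * Z ^ 2 * (s / min s 1) ^ 3 := by
        field_simp

/-- **The double sum against the exponent-7 kernel**: `Σ |F(s x)| |G(s y)| (1+‖x−y‖)⁻⁷ ≤ 64 C² Z₃² s² / min(s,1)³`.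
[folklore] -/
theorem doubleSum_kernel7_le (hC : 0 ≤ C)
    (hF : ∀ u : EuclideanSpace ℝ (Fin 4), |F u| ≤ C * |u 0| ^ 3 / (1 + ‖u‖) ^ 10)
    (hF0 : ∀ u : EuclideanSpace ℝ (Fin 4), 0 ≤ u 0 → F u = 0)
    (hG : ∀ u : EuclideanSpace ℝ (Fin 4), |G u| ≤ C * |u 0| ^ 3 / (1 + ‖u‖) ^ 10)
    (hG0 : ∀ u : EuclideanSpace ℝ (Fin 4), u 0 ≤ 0 → G u = 0)
    {s : ℝ} (hs : 0 < s) (X Y : Finset (Site 4)) :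
    ∑ x ∈ X, ∑ y ∈ Y, |F (s • siteToE x)| * |G (s • siteToE y)| * ((1 + ‖x - y‖) ^ 7)⁻¹ ≤
      64 * C ^ 2 * (3 ^ 3 * ∑' k : ℕ, (((k : ℝ) + 1) ^ 2)⁻¹) ^ 2 * s ^ 2 / (min s 1) ^ 3 := by
  classical
  set Z : ℝ := 3 ^ 3 * ∑' k : ℕ, (((k : ℝ) + 1) ^ 2)⁻¹ with hZ
  have hZ0 : 0 ≤ Z := riemann_const_nonneg 3
  have hmin : 0 < min s 1 := lt_min hs one_pos
  have hout : ∑ x ∈ X, ∑ y ∈ Y, |F (s • siteToE x)| * |G (s • siteToE y)| * ((1 + ‖x - y‖) ^ 7)⁻¹ =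
      ∑ x ∈ X.filter (fun x => x 0 ≤ -1), ∑ y ∈ Y.filter (fun y => 1 ≤ y 0),
        |F (s • siteToE x)| * |G (s • siteToE y)| * ((1 + ‖x - y‖) ^ 7)⁻¹ := by
    have h1 : ∀ x, ∑ y ∈ Y, |F (s • siteToE x)| * |G (s • siteToE y)| * ((1 + ‖x - y‖) ^ 7)⁻¹ =
        |F (s • siteToE x)| * ∑ y ∈ Y, |G (s • siteToE y)| * ((1 + ‖x - y‖) ^ 7)⁻¹ := by
      intro x; rw [Finset.mul_sum]; exact Finset.sum_congr rfl fun y _ => by ring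
    have h2 : ∀ x, ∑ y ∈ Y.filter (fun y => 1 ≤ y 0), |F (s • siteToE x)| * |G (s • siteToE y)| *
        ((1 + ‖x - y‖) ^ 7)⁻¹ =
        |F (s • siteToE x)| * ∑ y ∈ Y.filter (fun y => 1 ≤ y 0), |G (s • siteToE y)| * ((1 + ‖x - y‖) ^ 7)⁻¹ := by
      intro x; rw [Finset.mul_sum]; exact Finset.sum_congr rfl fun y _ => by ring
    simp_rw [h1]
    rw [sum_eq_sum_filter_neg hF0 hs]
    refine Finset.sum_congr rfl fun x _ => ?_
    rw [sum_eq_sum_filter_pos hG0 hs, h2]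
  rw [hout]
  have hterm : ∀ x ∈ X.filter (fun x => x 0 ≤ -1), ∀ y ∈ Y.filter (fun y => 1 ≤ y 0),
      |F (s • siteToE x)| * |G (s • siteToE y)| * ((1 + ‖x - y‖) ^ 7)⁻¹ ≤
        64 * C ^ 2 * ((s * (-(x 0 : ℝ))) ^ 3 / (1 + s * (-(x 0 : ℝ))) ^ 3 * ((1 + s * ‖Fin.tail x‖) ^ 7)⁻¹) *
          ((s * (y 0 : ℝ)) ^ 3 / (1 + s * (y 0 : ℝ)) ^ 3 /
            ((-(x 0 : ℝ) + (y 0 : ℝ)) * (1 + (-(x 0 : ℝ) + (y 0 : ℝ)) + ‖Fin.tail x - Fin.tail y‖) ^ 6)) := by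
    intro x hx y hy
    have hx1 : x 0 ≤ -1 := (Finset.mem_filter.1 hx).2
    have hy1 : 1 ≤ y 0 := (Finset.mem_filter.1 hy).2
    have h1 := abs_apply_smul_le_row hC hF hs x hx1
    have h2 := abs_apply_smul_le_col hC hG hs y hy1
    have h3 := inv_pow_seven_le x y hx1 hy1
    have ha : (1 : ℝ) ≤ -(x 0 : ℝ) := by
      have : ((x 0 : ℤ) : ℝ) ≤ -1 := by exact_mod_cast hx1
      linarith
    have hb : (1 : ℝ) ≤ (y 0 : ℝ) := by exact_mod_cast hy1
    calc |F (s • siteToE x)| * |G (s • siteToE y)| * ((1 + ‖x - y‖) ^ 7)⁻¹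
        ≤ (C * ((s * (-(x 0 : ℝ))) ^ 3 / (1 + s * (-(x 0 : ℝ))) ^ 3) * ((1 + s * ‖Fin.tail x‖) ^ 7)⁻¹) *
          (C * ((s * (y 0 : ℝ)) ^ 3 / (1 + s * (y 0 : ℝ)) ^ 3)) *
          (64 / ((-(x 0 : ℝ) + (y 0 : ℝ)) * (1 + (-(x 0 : ℝ) + (y 0 : ℝ)) + ‖Fin.tail x - Fin.tail y‖) ^ 6)) :=
          mul_le_mul (mul_le_mul h1 h2 (abs_nonneg _) (by positivity)) h3 (by positivity) (by positivity)
      _ = _ := by ring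
  have hinner : ∀ x ∈ X.filter (fun x => x 0 ≤ -1),
      ∑ y ∈ Y.filter (fun y => 1 ≤ y 0), |F (s • siteToE x)| * |G (s • siteToE y)| * ((1 + ‖x - y‖) ^ 7)⁻¹ ≤
        64 * C ^ 2 * ((s * (-(x 0 : ℝ))) ^ 3 / (1 + s * (-(x 0 : ℝ))) ^ 3 * ((1 + s * ‖Fin.tail x‖) ^ 7)⁻¹) *
          (Z * s / (-(x 0 : ℝ)) ^ 2) := by
    intro x hx
    have hx1 : x 0 ≤ -1 := (Finset.mem_filter.1 hx).2
    have ha : (1 : ℝ) ≤ -(x 0 : ℝ) := by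
      have : ((x 0 : ℤ) : ℝ) ≤ -1 := by exact_mod_cast hx1
      linarith
    refine (Finset.sum_le_sum (hterm x hx)).trans ?_
    rw [← Finset.mul_sum]
    exact mul_le_mul_of_nonneg_left (inner_sum_seven_le hs ha (Fin.tail x) Y) (by positivity)
  refine (Finset.sum_le_sum hinner).trans ?_
  have hre : ∀ x : Site 4,
      64 * C ^ 2 * ((s * (-(x 0 : ℝ))) ^ 3 / (1 + s * (-(x 0 : ℝ))) ^ 3 * ((1 + s * ‖Fin.tail x‖) ^ 7)⁻¹) *
          (Z * s / (-(x 0 : ℝ)) ^ 2) =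
        64 * C ^ 2 * Z * s * ((s * (-(x 0 : ℝ))) ^ 3 / (1 + s * (-(x 0 : ℝ))) ^ 3 / (-(x 0 : ℝ)) ^ 2 *
          ((1 + s * ‖Fin.tail x‖) ^ 7)⁻¹) := by
    intro x; ring
  simp_rw [hre]
  rw [← Finset.mul_sum]
  calc 64 * C ^ 2 * Z * s * ∑ x ∈ X.filter (fun x => x 0 ≤ -1),
          (s * (-(x 0 : ℝ))) ^ 3 / (1 + s * (-(x 0 : ℝ))) ^ 3 / (-(x 0 : ℝ)) ^ 2 * ((1 + s * ‖Fin.tail x‖) ^ 7)⁻¹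
      ≤ 64 * C ^ 2 * Z * s * (Z * s / (min s 1) ^ 3) :=
        mul_le_mul_of_nonneg_left (outer_sum_le hs X) (by positivity)
    _ = 64 * C ^ 2 * Z ^ 2 * s ^ 2 / (min s 1) ^ 3 := by
        field_simp

/-- **The FAR part of the double sum** (pairs with `R < s ‖x − y‖`, i.e. physical separation `> R` in the unit
`s`): `≤ 64 C² Z₃² s³ / (min(s,1)³ R)` — small for large `R`, uniformly in `s ∈ (0, s₀]`. [folklore] -/
theorem doubleSum_kernel8_far_le (hC : 0 ≤ C)
    (hF : ∀ u : EuclideanSpace ℝ (Fin 4), |F u| ≤ C * |u 0| ^ 3 / (1 + ‖u‖) ^ 10)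
    (hF0 : ∀ u : EuclideanSpace ℝ (Fin 4), 0 ≤ u 0 → F u = 0)
    (hG : ∀ u : EuclideanSpace ℝ (Fin 4), |G u| ≤ C * |u 0| ^ 3 / (1 + ‖u‖) ^ 10)
    (hG0 : ∀ u : EuclideanSpace ℝ (Fin 4), u 0 ≤ 0 → G u = 0)
    {s : ℝ} (hs : 0 < s) {R : ℝ} (hR : 0 < R) (X Y : Finset (Site 4)) :
    ∑ x ∈ X, ∑ y ∈ Y,
        (if R < s * ‖x - y‖ then |F (s • siteToE x)| * |G (s • siteToE y)| * ((1 + ‖x - y‖) ^ 8)⁻¹ else 0) ≤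
      64 * C ^ 2 * (3 ^ 3 * ∑' k : ℕ, (((k : ℝ) + 1) ^ 2)⁻¹) ^ 2 * s ^ 3 / ((min s 1) ^ 3 * R) := by
  set Z : ℝ := 3 ^ 3 * ∑' k : ℕ, (((k : ℝ) + 1) ^ 2)⁻¹ with hZ
  have hZ0 : 0 ≤ Z := riemann_const_nonneg 3
  have hmin : 0 < min s 1 := lt_min hs one_pos
  have hterm : ∀ x ∈ X, ∀ y ∈ Y,
      (if R < s * ‖x - y‖ then |F (s • siteToE x)| * |G (s • siteToE y)| * ((1 + ‖x - y‖) ^ 8)⁻¹ else 0) ≤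
        s / R * (|F (s • siteToE x)| * |G (s • siteToE y)| * ((1 + ‖x - y‖) ^ 7)⁻¹) := by
    intro x _ y _
    split_ifs with h
    · have hxy : R / s < ‖x - y‖ := by rw [div_lt_iff₀ hs]; linarith
      have h1 : ((1 + ‖x - y‖) ^ 8)⁻¹ ≤ s / R * ((1 + ‖x - y‖) ^ 7)⁻¹ := by
        have hpos : 0 < 1 + ‖x - y‖ := by positivity
        have h2 : (1 + ‖x - y‖)⁻¹ ≤ s / R := by
          rw [inv_le_comm₀ hpos (by positivity), inv_div]
          linarith
        calc ((1 + ‖x - y‖) ^ 8)⁻¹ = (1 + ‖x - y‖)⁻¹ * ((1 + ‖x - y‖) ^ 7)⁻¹ := by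
              rw [← mul_inv, ← pow_succ']
          _ ≤ s / R * ((1 + ‖x - y‖) ^ 7)⁻¹ := mul_le_mul_of_nonneg_right h2 (by positivity)
      calc |F (s • siteToE x)| * |G (s • siteToE y)| * ((1 + ‖x - y‖) ^ 8)⁻¹
          ≤ |F (s • siteToE x)| * |G (s • siteToE y)| * (s / R * ((1 + ‖x - y‖) ^ 7)⁻¹) :=
            mul_le_mul_of_nonneg_left h1 (by positivity)
        _ = _ := by ring
    · positivity
  calc ∑ x ∈ X, ∑ y ∈ Y,
          (if R < s * ‖x - y‖ then |F (s • siteToE x)| * |G (s • siteToE y)| * ((1 + ‖x - y‖) ^ 8)⁻¹ else 0)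
      ≤ ∑ x ∈ X, ∑ y ∈ Y, s / R * (|F (s • siteToE x)| * |G (s • siteToE y)| * ((1 + ‖x - y‖) ^ 7)⁻¹) :=
        Finset.sum_le_sum fun x hx => Finset.sum_le_sum fun y hy => hterm x hx y hy
    _ = s / R * ∑ x ∈ X, ∑ y ∈ Y, |F (s • siteToE x)| * |G (s • siteToE y)| * ((1 + ‖x - y‖) ^ 7)⁻¹ := by
        rw [Finset.mul_sum]
        exact Finset.sum_congr rfl fun x _ => by rw [Finset.mul_sum]
    _ ≤ s / R * (64 * C ^ 2 * Z ^ 2 * s ^ 2 / (min s 1) ^ 3) :=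
        mul_le_mul_of_nonneg_left (doubleSum_kernel7_le hC hF hF0 hG hG0 hs X Y) (by positivity)
    _ = 64 * C ^ 2 * Z ^ 2 * s ^ 3 / ((min s 1) ^ 3 * R) := by
        field_simp

end DoubleSums

end Summit.QuantumFields.YangMills.Cruxes.IR.AfOnset

end
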